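/-
Copyright (c) 2026 the pub-hodgecm-mathlib formalisation cell (harness21).  Prover seat hodgecm-mathlib-LH3-p02 (g3): line LH3 (closer stub `stub_N9`), organ J,
brick (B-STD) clause (iii) «φ(boost block) = hypBlockGL» (left open at F0P3a-p07 (g16)'s seat close 2026-09-02T08:48Z; LH3-plan (g3) RULINGS #9).
-/
import Literature.NumberTheory.Automorphic.ArchRankOneBlockStandardise     -- ★ p850476∕p850488 (F0P3a-p07 (g16)) (B-STD): `det_blockScale_ne_zero`, the value clause of `φ`
import Literature.NumberTheory.Automorphic.ArchInnerFormCartanAtlas         -- ★ `boostStd` (the standard boost over a real diagonal form), `sqrt_ratio_ne_zero`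
import Literature.NumberTheory.Automorphic.ArchRankOneSplitOrbitContinuity  -- ★ p850189 (F0P3a-p05): `hypBlockGL_mem_of_eq_over`; brings ★ `hypBlockGL`, `coe_hypBlockGL`
import HarnessLib

/-!
# (B-STD) clause (iii): the standardisation `φ : U(σ(diag a)) ≃ₜ* U(J)` carries the `{0,2}`-block of the standard boost to the split torus element `hypBlockGL x θ`
# (Platonov–Rapinchuk 1994 §2.3; Rogawski 1990 §3.6; Knapp 1986 Ch. V §3)

Topic `NumberTheory/Automorphic`; namespace `Literature.NumberTheory.Automorphic.UnitaryGroup`.  THEOREMS ONLY (no `def`, no instance, no notation, no axiom, no named fact, no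
`sorry`).  Cell `pub/hodgecm-mathlib`, line LH3 (closer stub `stub_N9`, crux H413 = `stmt-HodgeConjecture-24833`), organ J, brick **(B-STD) (iii)**: ★ p850476 fixes
`φ h = (P·D)·h·(P·D)⁻¹` (`P = (1 1; 1 −1)`, `D = diag(√(|e₀|∕2), √(|e₁|∕2))`, `e_i = re σ(a_i)`, `e₀e₁ < 0`) and proves its COMPACT-torus clause (i); ★ (M-UNFOLD) p850544 [5β] reads the
block coordinate of a CAYLEY-chart point as the `{0,2}`-block of the standard boost `boostStd b c` (`b 0 = e₀`, `b 2 = e₁`; entries `E·cosh x`, `E·r·sinh x`, `E·r⁻¹·sinh x`,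
`E·cosh x` with `x = c 0`, `E = e^{i c 2}`, `r = √(−b₂∕b₀)`).  This file proves the SPLIT-torus clause every β-side hand binds (LH3-p03 (g4)'s `h5β`, LH5-p02 (g3)'s [7β] →
`hTAβ`, the joiner's `hγβ`∕`hvert`∕`Ψβ`):  **`φ(h) = hypBlockGL (c 0) (c 2)`** whenever `h`'s matrix is that boost block.

THE COMPUTATION.  `D·M = (d₀E ch, d₀E r sh; d₁E r⁻¹ sh, d₁E ch)` and `d₁ = r·d₀` (`√(|b₂|∕2) = √(−b₂∕b₀)·√(|b₀|∕2)` for `b₀b₂ < 0`), so `P·D·M = H·P·D` with `H = diag(E e^{x}, E e^{−x})`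
entry by entry (`ch ± sh = e^{±x}`); hence `(P·D)·M·(P·D)⁻¹ = H = hypBlockGL x θ` (`E e^{±x} = e^{±x + iθ}`).

* §1 `sqrt_abs_div_two_eq` (`d₁ = r·d₀`), `cexp_mul_I_mul_ofReal_exp` ∕ `…_neg` (`E·e^{±x} = e^{±x+iθ}`);
* §2 **`cayley_blockScale_mul_boost_submatrix`** — the matrix identity `P·D·M = H·P·D`;
* §3 **`coe_std_eq_hypBlockGL_of_coe_eq_boost`** — clause (iii) for any `φ` with ★ p850476's value formula, and the `Subtype` form `std_eq_hypBlockGL_of_coe_eq_boost`.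
HONEST LABEL: HC_CM is proved only modulo the 7 printed citations (2 remaining: hLiu418 = stmt-HodgeConjecture-24832, h413 = stmt-HodgeConjecture-24833) until rung 0 closes; frame
bookkeeping (2 × 2 matrix algebra), count-neutral.

## References
* [PlatonovRapinchuk1994] V. Platonov, A. Rapinchuk, *Algebraic Groups and Number Theory* (1994), §2.3.
* [Rogawski1990] J. D. Rogawski, *Automorphic Representations of Unitary Groups in Three Variables*, Ann. of Math. Stud. 123 (1990), §3.6 p. 31 (split Cartan of `U(1,1)`), §8.2 p. 122.
* [Knapp1986] A. W. Knapp, *Representation Theory of Semisimple Groups*, Princeton (1986), Ch. V §3 (the boost and its Cayley diagonalisation).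
-/

set_option autoImplicit false

noncomputable section

namespace Literature.NumberTheory.Automorphic.UnitaryGroup

open _root_.Complex
open scoped Real MatrixGroups

/-! ## §1 Scalars -/

/-- **`d₁ = r·d₀`**: `√(|b₂|∕2) = √(−b₂∕b₀)·√(|b₀|∕2)` for `b₀b₂ < 0`. [cite: Knapp1986, Ch. V §3] -/
theorem sqrt_abs_div_two_eq (b : Fin 3 → ℝ) (hb : b 0 * b 2 < 0) :
    Real.sqrt (|b 2| / 2) = Real.sqrt (-b 2 / b 0) * Real.sqrt (|b 0| / 2) := by
  have hb0 : b 0 ≠ 0 := fun h => by rw [h, zero_mul] at hb; exact lt_irrefl _ hb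
  have hq : 0 ≤ -b 2 / b 0 := by
    rcases lt_or_gt_of_ne hb0 with h | h
    · have : 0 < b 2 := by nlinarith
      exact le_of_lt (div_pos_of_neg_of_neg (by linarith) h)
    · have : b 2 < 0 := by nlinarith
      exact le_of_lt (div_pos (by linarith) h)
  rw [← Real.sqrt_mul hq]
  congr 1
  rcases lt_or_gt_of_ne hb0 with h | h
  · have h2 : 0 < b 2 := by nlinarith
    rw [abs_of_pos h2, abs_of_neg h]
    field_simp
  · have h2 : b 2 < 0 := by nlinarith
    rw [abs_of_neg h2, abs_of_pos h]
    field_simp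

/-- `e^{iθ}·e^{x} = e^{x+iθ}` (real `x`, as complex numbers). [cite: Rogawski1990, §3.6 p. 31] -/
theorem cexp_mul_I_mul_ofReal_exp (x θ : ℝ) :
    Complex.exp ((θ : ℂ) * I) * ((Real.exp x : ℝ) : ℂ) = Complex.exp ((x : ℂ) + (θ : ℂ) * I) := by
  rw [Complex.ofReal_exp, ← Complex.exp_add, add_comm]

/-- `e^{iθ}·e^{−x} = e^{−x+iθ}`. [cite: Rogawski1990, §3.6 p. 31] -/
theorem cexp_mul_I_mul_ofReal_exp_neg (x θ : ℝ) :
    Complex.exp ((θ : ℂ) * I) * ((Real.exp (-x) : ℝ) : ℂ) = Complex.exp (-(x : ℂ) + (θ : ℂ) * I) := by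
  rw [Complex.ofReal_exp, ← Complex.exp_add, add_comm, Complex.ofReal_neg]

/-! ## §2 The matrix identity `P·D·M = H·P·D` -/

/-- **`(P·D)·M = hypBlock·(P·D)`** for the `{0,2}`-block `M` of the standard boost `boostStd b c` (`b₀b₂ < 0`): `P = (1 1; 1 −1)`, `D = diag(√(|b₀|∕2), √(|b₂|∕2))`,
`hypBlock = diag(e^{x+iθ}, e^{−x+iθ})`, `x = c 0`, `θ = c 2` — the Cayley diagonalisation of the boost, with the (B-STD) scaling absorbing the ratio `r = √(−b₂∕b₀)`.
[cite: Knapp1986, Ch. V §3] [cite: PlatonovRapinchuk1994, §2.3] [cite: Rogawski1990, §3.6 p. 31] -/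
theorem cayley_blockScale_mul_boost_submatrix (b : Fin 3 → ℝ) (hb : b 0 * b 2 < 0) (c : Fin 3 → ℝ) :
    (!![(1 : ℂ), 1; 1, -1] * Matrix.diagonal ![((Real.sqrt (|b 0| / 2) : ℝ) : ℂ), ((Real.sqrt (|b 2| / 2) : ℝ) : ℂ)]) *
        (boostStd b c).submatrix ![0, 2] ![0, 2] =
      !![Complex.exp ((c 0 : ℂ) + (c 2 : ℂ) * I), 0; 0, Complex.exp (-(c 0 : ℂ) + (c 2 : ℂ) * I)] *
        (!![(1 : ℂ), 1; 1, -1] * Matrix.diagonal ![((Real.sqrt (|b 0| / 2) : ℝ) : ℂ), ((Real.sqrt (|b 2| / 2) : ℝ) : ℂ)]) := by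
  -- the scalars: `d₁ = r·d₀`, `r ≠ 0`
  have hr0 : Real.sqrt (-b 2 / b 0) ≠ 0 := sqrt_ratio_ne_zero hb
  have hr0' : ((Real.sqrt (-b 2 / b 0) : ℝ) : ℂ) ≠ 0 := Complex.ofReal_ne_zero.2 hr0
  have hd : ((Real.sqrt (|b 2| / 2) : ℝ) : ℂ) = ((Real.sqrt (-b 2 / b 0) : ℝ) : ℂ) * ((Real.sqrt (|b 0| / 2) : ℝ) : ℂ) := by
    rw [← Complex.ofReal_mul, sqrt_abs_div_two_eq b hb]
  -- `cosh ± sinh = e^{±x}` and `E·e^{±x} = e^{±x+iθ}`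
  have hp : Complex.exp ((c 0 : ℂ) + (c 2 : ℂ) * I) = Complex.exp ((c 2 : ℂ) * I) * ((Real.cosh (c 0) : ℂ) + (Real.sinh (c 0) : ℂ)) := by
    rw [← Complex.ofReal_add, Real.cosh_add_sinh, cexp_mul_I_mul_ofReal_exp]
  have hm : Complex.exp (-(c 0 : ℂ) + (c 2 : ℂ) * I) = Complex.exp ((c 2 : ℂ) * I) * ((Real.cosh (c 0) : ℂ) - (Real.sinh (c 0) : ℂ)) := by
    rw [← Complex.ofReal_sub, Real.cosh_sub_sinh, cexp_mul_I_mul_ofReal_exp_neg]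
  -- the three explicit 2 × 2 matrices
  have hPD : !![(1 : ℂ), 1; 1, -1] * Matrix.diagonal ![((Real.sqrt (|b 0| / 2) : ℝ) : ℂ), ((Real.sqrt (|b 2| / 2) : ℝ) : ℂ)] =
      !![((Real.sqrt (|b 0| / 2) : ℝ) : ℂ), ((Real.sqrt (|b 2| / 2) : ℝ) : ℂ); ((Real.sqrt (|b 0| / 2) : ℝ) : ℂ), -((Real.sqrt (|b 2| / 2) : ℝ) : ℂ)] := by
    ext i j
    fin_cases i <;> fin_cases j <;> simp [Matrix.mul_apply, Fin.sum_univ_two]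
  have hM : (boostStd b c).submatrix ![0, 2] ![0, 2] =
      !![Complex.exp ((c 2 : ℂ) * I) * (Real.cosh (c 0) : ℂ), Complex.exp ((c 2 : ℂ) * I) * (Real.sqrt (-b 2 / b 0) : ℂ) * (Real.sinh (c 0) : ℂ);
         Complex.exp ((c 2 : ℂ) * I) * ((Real.sqrt (-b 2 / b 0))⁻¹ : ℂ) * (Real.sinh (c 0) : ℂ), Complex.exp ((c 2 : ℂ) * I) * (Real.cosh (c 0) : ℂ)] := by
    ext i j
    fin_cases i <;> fin_cases j <;> rfl
  have hrr : ((Real.sqrt (-b 2 / b 0) : ℝ) : ℂ) * ((Real.sqrt (-b 2 / b 0) : ℝ) : ℂ)⁻¹ = 1 := mul_inv_cancel₀ hr0'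
  rw [hPD, hM, Matrix.mul_fin_two, Matrix.mul_fin_two, hd, hp, hm]
  ext i j
  fin_cases i <;> fin_cases j <;>
    simp only [Fin.isValue, Fin.zero_eta, Fin.mk_one, Matrix.of_apply, Matrix.cons_val', Matrix.cons_val_zero, Matrix.cons_val_one,
      Matrix.empty_val', Matrix.cons_val_fin_one] <;>
    first
      | ring1
      | linear_combination (((Real.sqrt (|b 0| / 2) : ℝ) : ℂ) * Complex.exp ((c 2 : ℂ) * I) * (Real.sinh (c 0) : ℂ)) * hrr
      | linear_combination (-(((Real.sqrt (|b 0| / 2) : ℝ) : ℂ) * Complex.exp ((c 2 : ℂ) * I) * (Real.sinh (c 0) : ℂ))) * hrr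

/-! ## §3 Clause (iii) -/

variable {L : Type*} [CommRing L] (σ : L →+* ℂ) (a : Fin 2 → L)
variable {J : Matrix (Fin 2) (Fin 2) ℂ} (hJ : J = (StdForm.antidiagonal 2).over ℂ)

/-- **(B-STD) (iii) — THE STANDARDISATION READS THE BOOST BLOCK AS THE SPLIT TORUS ELEMENT.**  For any `φ : U(σ(diag a)) ≃ₜ* U(J)` with ★ p850476's value formula
`φ h = (P·D)·h·(P·D)⁻¹` (`D = diag(√(|re σ(a₀)|∕2), √(|re σ(a₁)|∕2))`), any real weight vector `b` with `b 0 = re σ(a₀)`, `b 2 = re σ(a₁)` of opposite signs, and any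
`h ∈ U(σ(diag a))` whose matrix is the `{0,2}`-block of `boostStd b c`:  **`φ h = hypBlockGL (c 0) (c 2)`** in `GL₂(ℂ)` — the element `⟨hypBlockGL x θ, _⟩` of (A0-b∕c) ★
p850189∕p850345 and of the shared datum's `hA0`∕`hlink`.  (LH3 instance: `σ := σ_{w₀}`, `a := (α_{τ0}, α_{τ2})`, `b := formRe α w₀ ∘ τ₀` with `hb0 hb2 := rfl`, `hh :=` ★ p850544 [5β].)
[cite: PlatonovRapinchuk1994, §2.3] [cite: Knapp1986, Ch. V §3] [cite: Rogawski1990, §3.6 p. 31; §8.2 p. 122] -/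
theorem coe_std_eq_hypBlockGL_of_coe_eq_boost (hsgn : (σ (a 0)).re * (σ (a 1)).re < 0)
    (φ : ↥(unitaryGroupOfForm (starRingEnd ℂ) ((Matrix.diagonal a).map σ)) ≃ₜ* ↥(unitaryGroupOfForm (starRingEnd ℂ) J))
    (hval : ∀ h : ↥(unitaryGroupOfForm (starRingEnd ℂ) ((Matrix.diagonal a).map σ)),
      ((φ h : ↥(unitaryGroupOfForm (starRingEnd ℂ) J)) : GL (Fin 2) ℂ) =
        Matrix.GeneralLinearGroup.mkOfDetNeZero !![(1 : ℂ), 1; 1, -1] det_cayleyTwo_ne_zero *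
          Matrix.GeneralLinearGroup.mkOfDetNeZero
            (Matrix.diagonal ![((Real.sqrt (|(σ (a 0)).re| / 2) : ℝ) : ℂ), ((Real.sqrt (|(σ (a 1)).re| / 2) : ℝ) : ℂ)])
            (det_blockScale_ne_zero _ _ hsgn) * (h : GL (Fin 2) ℂ) *
        (Matrix.GeneralLinearGroup.mkOfDetNeZero !![(1 : ℂ), 1; 1, -1] det_cayleyTwo_ne_zero *
          Matrix.GeneralLinearGroup.mkOfDetNeZero
            (Matrix.diagonal ![((Real.sqrt (|(σ (a 0)).re| / 2) : ℝ) : ℂ), ((Real.sqrt (|(σ (a 1)).re| / 2) : ℝ) : ℂ)])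
            (det_blockScale_ne_zero _ _ hsgn))⁻¹)
    (b : Fin 3 → ℝ) (hb0 : b 0 = (σ (a 0)).re) (hb2 : b 2 = (σ (a 1)).re) (c : Fin 3 → ℝ)
    (h : ↥(unitaryGroupOfForm (starRingEnd ℂ) ((Matrix.diagonal a).map σ)))
    (hh : ((h : GL (Fin 2) ℂ) : Matrix (Fin 2) (Fin 2) ℂ) = (boostStd b c).submatrix ![0, 2] ![0, 2]) :
    ((φ h : ↥(unitaryGroupOfForm (starRingEnd ℂ) J)) : GL (Fin 2) ℂ) = hypBlockGL (c 0) (c 2) := by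
  have hb : b 0 * b 2 < 0 := by rw [hb0, hb2]; exact hsgn
  have key := cayley_blockScale_mul_boost_submatrix b hb c
  rw [hb0, hb2] at key
  rw [hval h, mul_inv_eq_iff_eq_mul]
  apply Units.ext
  simpa only [Units.val_mul, Matrix.GeneralLinearGroup.val_mkOfDetNeZero, coe_hypBlockGL, hh] using key

/-- **(iii) in `Subtype` form**: `φ h = ⟨hypBlockGL (c 0) (c 2), _⟩` as elements of `U(J)` (membership ★ `hypBlockGL_mem_of_eq_over`). [cite: Rogawski1990, §3.6 p. 31] -/
theorem std_eq_hypBlockGL_of_coe_eq_boost (hsgn : (σ (a 0)).re * (σ (a 1)).re < 0)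
    (φ : ↥(unitaryGroupOfForm (starRingEnd ℂ) ((Matrix.diagonal a).map σ)) ≃ₜ* ↥(unitaryGroupOfForm (starRingEnd ℂ) J))
    (hval : ∀ h : ↥(unitaryGroupOfForm (starRingEnd ℂ) ((Matrix.diagonal a).map σ)),
      ((φ h : ↥(unitaryGroupOfForm (starRingEnd ℂ) J)) : GL (Fin 2) ℂ) =
        Matrix.GeneralLinearGroup.mkOfDetNeZero !![(1 : ℂ), 1; 1, -1] det_cayleyTwo_ne_zero *
          Matrix.GeneralLinearGroup.mkOfDetNeZero
            (Matrix.diagonal ![((Real.sqrt (|(σ (a 0)).re| / 2) : ℝ) : ℂ), ((Real.sqrt (|(σ (a 1)).re| / 2) : ℝ) : ℂ)])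
            (det_blockScale_ne_zero _ _ hsgn) * (h : GL (Fin 2) ℂ) *
        (Matrix.GeneralLinearGroup.mkOfDetNeZero !![(1 : ℂ), 1; 1, -1] det_cayleyTwo_ne_zero *
          Matrix.GeneralLinearGroup.mkOfDetNeZero
            (Matrix.diagonal ![((Real.sqrt (|(σ (a 0)).re| / 2) : ℝ) : ℂ), ((Real.sqrt (|(σ (a 1)).re| / 2) : ℝ) : ℂ)])
            (det_blockScale_ne_zero _ _ hsgn))⁻¹)
    (b : Fin 3 → ℝ) (hb0 : b 0 = (σ (a 0)).re) (hb2 : b 2 = (σ (a 1)).re) (c : Fin 3 → ℝ)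
    (h : ↥(unitaryGroupOfForm (starRingEnd ℂ) ((Matrix.diagonal a).map σ)))
    (hh : ((h : GL (Fin 2) ℂ) : Matrix (Fin 2) (Fin 2) ℂ) = (boostStd b c).submatrix ![0, 2] ![0, 2]) :
    φ h = ⟨hypBlockGL (c 0) (c 2), hypBlockGL_mem_of_eq_over hJ (c 0) (c 2)⟩ :=
  Subtype.ext (coe_std_eq_hypBlockGL_of_coe_eq_boost σ a hsgn φ hval b hb0 hb2 c h hh)

end Literature.NumberTheory.Automorphic.UnitaryGroup

end
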